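import Summits.QuantumFields.BalabanUV.Beta.GAN24.CombT2RecChargeStep
import Summits.QuantumFields.BalabanUV.Beta.GAN24.CombChargeTowerStepDeep

/-!
# `BalabanUV.Beta.GAN24.CombChartChargeTowerStepDeep` — binder row G-an2-4 ∕ (CONV-C), TRANSFER-III, the (III′) (C)-campaign in branch (i) of E0: **THE PERIOD-INDEX-`m ≥ 1` ROWS AT THE
# COMB-CHART DATA, PART 1 — the next member's period-`P` four exit-face read is the comb forcing's plus `c·K_j⁴∕2` times the bond-symmetrised period-`Lc·P` read of the
# FOUR-SLOT-TRANSPORTED member `𝒯₄ T̃′♮_j`** — the (III′) twin of road-P2 g50's `CombChargeTowerStepDeep` §2 (`faceRead_member_succ` ∕ `faceReadSym_member_succ`), with the E-frame split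
# taken from road-P2's `succ_combChart` ⨾ leaf-01 g84's `lin4_unitK_GcombSh_eq_fourSlot` and the transport row from road-P2's OWN `faceRead_lin4_coDress_bondSym` at the centred root on
# the transported table (OWNER `b2b-balaban-gan24-p1`, gen 51; no existing file touched; road-P2's §1 helpers `faceRead_conj_add` ∕ `faceRead_lin4_coDress_bondSym` imported BY NAME, not re-typed)

NOT IN PRINT; OUR BOOKKEEPING ([folklore] composition BY NAME at weight 0; 0 `def`, 0 cited facts, 0 `def … : Prop`, 0 sorry).  HONEST FRAMING (cell contract, verbatim): «discharging
`BetaPertH` makes Bałaban's UV stability UNCONDITIONAL — a real constructive-QFT result; it is NOT the continuum limit and NOT the Clay problem.»  HONEST DEPENDENCY (verbatim): «continuum YM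
on T⁴ ⇐ BetaPertH ∧ nine spine estimates (0/9 proved); BetaPertH ⇐ (D1) ∧ (D4) ∧ CAP+tail; G-an2-4 gates asym, D1 and NE2/3/4.»

WHAT (generic `d`, any sym record `tabs`, every level `j`, every coarse period `P ≥ 1`, ALL constants symbolic; `FF_M(Y)(μ,ν;α,β)` in road-P2's ONE-conjunctive-mask form VERBATIM;
`Y_j := 𝒯₄ T̃′♮_j`; `c·K_j⁴ = (cE₂·Lc^{2(d+1)})·(s_f s_m (stepScale_j·Lc^{d+1})⁻¹)⁴`):
* **`faceRead_member_succ`** — `FF_P(T̃′♮_{j+1})(μ,ν;α,β) = FF_P(b̃′♮_j)(μ,ν;α,β) + (c·K_j⁴∕2)·(FF_{Lc·P}(Y_j)(μ,ν;α,β) + FF_{Lc·P}(Y_j)(ν,μ;α,β))`;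
* **`faceReadSym_member_succ`** — the bond-symmetrised form `FFsym_P(T̃′♮_{j+1}) = FFsym_P(b̃′♮_j) + c·K_j⁴·FFsym_{Lc·P}(Y_j)`.
The `LS` rows ∕ `hstep (m ≥ 1, j)` packaging (road-P2's `CombChargeTowerStepDeepRows`) and the pin (`…StepDeepPin`: `c·K_j⁴ = 1` at `d = 3`, `cE₂ = Lc⁸`) are the sequel, token for token.
WHAT THIS IS NOT.  Asserts NO value and NO shape of any table; discharges NOTHING of (C)_{≥1} ∕ `hstep` ∕ the forcing's face pair forms ∕ (d′) ∕ (d″); NEVER «G-an2-4 closed» as (CONV-C);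
NOT D1, NOT `BetaPertH`, NOT continuum, NOT Clay; not in print.  2026-08-27.
-/

noncomputable section

open Finset
open scoped BigOperators
open Literature.MathematicalPhysics.QuantumFieldTheory
open Literature.MathematicalPhysics.QuantumFieldTheory.Balaban1983to89
open Literature.MathematicalPhysics.QuantumFieldTheory.Balaban1983to89.Beta
open ExpKernelCalculus (MKer Decays comp shiftK)
open OneStepResolventKernel (Fib)
open OneStepKernelFamily (KInvStep)
open AffineAveraging (Site box toSite)
open AveragingContoursRooted (ctrOff ctrOff_mem_box)
open BalabanCompositeJets (LocStencil₂)
open SecondOrderResponse (W2SymOfK)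
open BalabanStepJetsSucc (mmRead)
open BalabanStepW2 (K3OfK M2Of)
open Summit.QuantumFields.BalabanUV.Beta.BorderedHessian (stepScale)
open Summit.QuantumFields.BalabanUV.Beta.TameKernelCalculus (trK)
open Summit.QuantumFields.BalabanUV.Beta.HessKerDressedUnits (unitK unitS decays_unitK)
open Summit.QuantumFields.BalabanUV.Beta.SecondOrderUnits (unitM unitS₂ unitM₂)
open Summit.QuantumFields.BalabanUV.Beta.AxialDressingRooted (coDressKBmAt decays_coDressKBmAt_KInvStep one_le_of_neZero)
open Summit.QuantumFields.BalabanUV.Beta.SpineRooted (T2RecOf)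
open Summit.QuantumFields.BalabanUV.Beta.SymmetrisedStepJets (SymTables)
open Summit.QuantumFields.BalabanUV.Beta.CombChartStepJets (GcombSh SpureCombOf)
open Summit.QuantumFields.BalabanUV.Beta.SymCorrectorKernel (psiKS)
open Summit.QuantumFields.BalabanUV.Beta.SymCorrectorFace (slotPsiS)
open Summit.QuantumFields.BalabanUV.Beta.GAN24.CombesThomas (sfStep smStep)
open Summit.QuantumFields.BalabanUV.Beta.GAN24.T2RecursionAffine (lin4)
open Summit.QuantumFields.BalabanUV.Beta.GAN24.BiStencilZeroMode (Tab)
open Summit.QuantumFields.BalabanUV.Beta.GAN24.Lin4ZeroMode (locStencil₂_lin4)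
open Summit.QuantumFields.BalabanUV.Beta.GAN24.CombRelSourceHalfCharge (locStencil₂_unitS₂_T2RecOf_comb)
open Summit.QuantumFields.BalabanUV.Beta.GAN24.CombLegSourceRuledClass (succ_combChart exists_locStencil₂_source_combChart)
open Summit.QuantumFields.BalabanUV.Beta.GAN24.CombTransportZeroMode (lin4_unitK_GcombSh_eq_fourSlot)
open Summit.QuantumFields.BalabanUV.Beta.GAN24.CombT2RecChargeStep (shape_fourSlot_member fourSlot_member_translate)
open Summit.QuantumFields.BalabanUV.Beta.GAN24.CombChargeTowerStepDeep (faceRead_conj_add faceRead_lin4_coDress_bondSym)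

namespace Summit.QuantumFields.BalabanUV.Beta.GAN24.CombChartChargeTowerStepDeep

variable {d : ℕ} {Lc : ℕ} [NeZero Lc]

/-- NOT IN PRINT; OUR BOOKKEEPING.  **THE PERIOD-`P` FACE READ OF THE NEXT COMB-CHART MEMBER** (generic constants, every `j`, every `P ≥ 1`):
`FF_P(T̃′♮_{j+1})(μ,ν;α,β) = FF_P(b̃′♮_j)(μ,ν;α,β) + (c·K_j⁴∕2)·(FF_{Lc·P}(Y_j)(μ,ν;α,β) + FF_{Lc·P}(Y_j)(ν,μ;α,β))`, `Y_j = 𝒯₄ T̃′♮_j` — the split `T̃′♮_{j+1} = lin4 c (unitK_j Ĝ_{ρ_c,j}) Lc Y_j + b̃′♮_j`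
(road-P2's `succ_combChart` ⨾ leaf-01 g84's `lin4_unitK_GcombSh_eq_fourSlot`), additivity of the face read (road-P2's `faceRead_conj_add`; classes `locStencil₂_lin4` on MY `shape_fourSlot_member`,
road-P2's `exists_locStencil₂_source_combChart`), the transport row (road-P2's `faceRead_lin4_coDress_bondSym` at `ρ_c` on `Y_j`, covariant by MY `fourSlot_member_translate`). -/
theorem faceRead_member_succ (tabs : SymTables d Lc) (cE cVH cΛ cE₂ cB : ℝ) (Tc : Fin 4 → Fin 4 → Fin 4 → Fin 4 → ℝ)
    (hBff : ∀ κ u κ' u' x z (α β : Fin (d + 1)), tabs.vh₂S κ u κ' u' x z (Sum.inl α) (Sum.inl β) = 0)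
    (hBmm : ∀ κ u κ' u' x z (μ ν : Fin (d + 1)), tabs.vh₂S κ u κ' u' x z (Sum.inr μ) (Sum.inr ν) = 0)
    {P : ℕ} [NeZero (Lc * P)] (hP : 1 ≤ P) (j : ℕ) (μ ν α β : Fin (d + 1)) :
    (∑ b ∈ box (d + 1) P, ∑' u' : Site (d + 1), ∑' x : Site (d + 1), ∑' z : Site (d + 1),
          (if toSite b μ % (P : ℤ) = (P : ℤ) - 1 ∧ u' ν % (P : ℤ) = (P : ℤ) - 1 ∧ x α % (P : ℤ) = (P : ℤ) - 1 ∧ z β % (P : ℤ) = (P : ℤ) - 1 then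
            unitS₂ (sfStep Lc (j + 1)) (smStep d Lc (j + 1)) (T2RecOf d Lc (GcombSh Lc) (SpureCombOf tabs cE cVH cΛ) tabs.M cE₂ cB Tc tabs.vh₂S tabs.mixFF (j + 1)) μ (toSite b) ν u' x z (Sum.inl α) (Sum.inl β) else 0))
      = (∑ b ∈ box (d + 1) P, ∑' u' : Site (d + 1), ∑' x : Site (d + 1), ∑' z : Site (d + 1),
          (if toSite b μ % (P : ℤ) = (P : ℤ) - 1 ∧ u' ν % (P : ℤ) = (P : ℤ) - 1 ∧ x α % (P : ℤ) = (P : ℤ) - 1 ∧ z β % (P : ℤ) = (P : ℤ) - 1 then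
            (fun κ u κ' u' => (cE₂ * (Lc : ℝ) ^ (2 * (d + 1))) • mmRead Lc (K3OfK (unitK (sfStep Lc j) (smStep d Lc j) (GcombSh (d := d) Lc j)) Lc (unitS (sfStep Lc j) (smStep d Lc j) (SpureCombOf tabs cE cVH cΛ j)) (unitM (sfStep Lc j) (smStep d Lc j) (tabs.M j)) (W2SymOfK (unitK (sfStep Lc j) (smStep d Lc j) (GcombSh (d := d) Lc j)) Lc (unitS (sfStep Lc j) (smStep d Lc j) (SpureCombOf tabs cE cVH cΛ j)) (unitM (sfStep Lc j) (smStep d Lc j) (tabs.M j)) 0 (unitM₂ (sfStep Lc j) (smStep d Lc j) (M2Of d Lc tabs.mixFF j))) κ u κ' u') + cB • tabs.vh₂S κ u κ' u') μ (toSite b) ν u' x z (Sum.inl α) (Sum.inl β) else 0))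
        + ((cE₂ * (Lc : ℝ) ^ (2 * (d + 1))) * (sfStep Lc j * smStep d Lc j * (stepScale d Lc j * (Lc : ℝ) ^ (d + 1))⁻¹) ^ 4 / 2) *
          ( (∑ b ∈ box (d + 1) (Lc * P), ∑' u' : Site (d + 1), ∑' x : Site (d + 1), ∑' z : Site (d + 1),
          (if toSite b μ % ((Lc * P : ℕ) : ℤ) = ((Lc * P : ℕ) : ℤ) - 1 ∧ u' ν % ((Lc * P : ℕ) : ℤ) = ((Lc * P : ℕ) : ℤ) - 1 ∧ x α % ((Lc * P : ℕ) : ℤ) = ((Lc * P : ℕ) : ℤ) - 1 ∧ z β % ((Lc * P : ℕ) : ℤ) = ((Lc * P : ℕ) : ℤ) - 1 then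
            comp (comp (trK (psiKS (ctrOff (d + 1) Lc) Lc)) (slotPsiS (ctrOff (d + 1) Lc) Lc (slotPsiS (ctrOff (d + 1) Lc) Lc (unitS₂ (sfStep Lc j) (smStep d Lc j) (T2RecOf d Lc (GcombSh Lc) (SpureCombOf tabs cE cVH cΛ) tabs.M cE₂ cB Tc tabs.vh₂S tabs.mixFF j)) μ (toSite b)) ν u')) (psiKS (ctrOff (d + 1) Lc) Lc) x z (Sum.inl α) (Sum.inl β) else 0))
          + (∑ b ∈ box (d + 1) (Lc * P), ∑' u' : Site (d + 1), ∑' x : Site (d + 1), ∑' z : Site (d + 1),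
          (if toSite b ν % ((Lc * P : ℕ) : ℤ) = ((Lc * P : ℕ) : ℤ) - 1 ∧ u' μ % ((Lc * P : ℕ) : ℤ) = ((Lc * P : ℕ) : ℤ) - 1 ∧ x α % ((Lc * P : ℕ) : ℤ) = ((Lc * P : ℕ) : ℤ) - 1 ∧ z β % ((Lc * P : ℕ) : ℤ) = ((Lc * P : ℕ) : ℤ) - 1 then
            comp (comp (trK (psiKS (ctrOff (d + 1) Lc) Lc)) (slotPsiS (ctrOff (d + 1) Lc) Lc (slotPsiS (ctrOff (d + 1) Lc) Lc (unitS₂ (sfStep Lc j) (smStep d Lc j) (T2RecOf d Lc (GcombSh Lc) (SpureCombOf tabs cE cVH cΛ) tabs.M cE₂ cB Tc tabs.vh₂S tabs.mixFF j)) ν (toSite b)) μ u')) (psiKS (ctrOff (d + 1) Lc) Lc) x z (Sum.inl α) (Sum.inl β) else 0)) ) := by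
  have hLc : 1 ≤ Lc := one_le_of_neZero Lc
  have hr := ctrOff_mem_box (d := d + 1) hLc
  obtain ⟨CT, δT, hδT, hT⟩ := locStencil₂_unitS₂_T2RecOf_comb tabs cE cVH cΛ cE₂ cB Tc j
  obtain ⟨CY, δY, hδY, hY⟩ := shape_fourSlot_member tabs cE cVH cΛ cE₂ cB Tc j
  have hYcov := fourSlot_member_translate tabs cE cVH cΛ cE₂ cB Tc j
  obtain ⟨Cb, δb, hδb, hb⟩ := exists_locStencil₂_source_combChart tabs cE cVH cΛ cE₂ cB Tc hBff hBmm j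
  obtain ⟨m, CK, hm, hCK, hG⟩ := decays_coDressKBmAt_KInvStep (d := d) hr j
  have hGu : Decays (unitK (sfStep Lc j) (smStep d Lc j) (coDressKBmAt (toSite (ctrOff (d + 1) Lc)) Lc (KInvStep (d := d) Lc j))) (max |sfStep Lc j| |smStep d Lc j| * CK * max |sfStep Lc j| |smStep d Lc j|) m := decays_unitK hG
  have hA := locStencil₂_lin4 hGu (by positivity) hm hLc (cE₂ * (Lc : ℝ) ^ (2 * (d + 1))) hY hδY
  have hsplit : unitS₂ (sfStep Lc (j + 1)) (smStep d Lc (j + 1)) (T2RecOf d Lc (GcombSh Lc) (SpureCombOf tabs cE cVH cΛ) tabs.M cE₂ cB Tc tabs.vh₂S tabs.mixFF (j + 1))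
      = lin4 (cE₂ * (Lc : ℝ) ^ (2 * (d + 1))) (unitK (sfStep Lc j) (smStep d Lc j) (coDressKBmAt (toSite (ctrOff (d + 1) Lc)) Lc (KInvStep (d := d) Lc j))) Lc
          (fun κ₁ u₁ κ₂ u₂ => comp (comp (trK (psiKS (ctrOff (d + 1) Lc) Lc)) (slotPsiS (ctrOff (d + 1) Lc) Lc (slotPsiS (ctrOff (d + 1) Lc) Lc (unitS₂ (sfStep Lc j) (smStep d Lc j) (T2RecOf d Lc (GcombSh Lc) (SpureCombOf tabs cE cVH cΛ) tabs.M cE₂ cB Tc tabs.vh₂S tabs.mixFF j)) κ₁ u₁) κ₂ u₂)) (psiKS (ctrOff (d + 1) Lc) Lc))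
        + (fun κ u κ' u' => (cE₂ * (Lc : ℝ) ^ (2 * (d + 1))) • mmRead Lc (K3OfK (unitK (sfStep Lc j) (smStep d Lc j) (GcombSh (d := d) Lc j)) Lc (unitS (sfStep Lc j) (smStep d Lc j) (SpureCombOf tabs cE cVH cΛ j)) (unitM (sfStep Lc j) (smStep d Lc j) (tabs.M j)) (W2SymOfK (unitK (sfStep Lc j) (smStep d Lc j) (GcombSh (d := d) Lc j)) Lc (unitS (sfStep Lc j) (smStep d Lc j) (SpureCombOf tabs cE cVH cΛ j)) (unitM (sfStep Lc j) (smStep d Lc j) (tabs.M j)) 0 (unitM₂ (sfStep Lc j) (smStep d Lc j) (M2Of d Lc tabs.mixFF j))) κ u κ' u') + cB • tabs.vh₂S κ u κ' u') := by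
    have e4 : lin4 (cE₂ * (Lc : ℝ) ^ (2 * (d + 1))) (unitK (sfStep Lc j) (smStep d Lc j) (GcombSh (d := d) Lc j)) Lc (unitS₂ (sfStep Lc j) (smStep d Lc j) (T2RecOf d Lc (GcombSh Lc) (SpureCombOf tabs cE cVH cΛ) tabs.M cE₂ cB Tc tabs.vh₂S tabs.mixFF j))
        = lin4 (cE₂ * (Lc : ℝ) ^ (2 * (d + 1))) (unitK (sfStep Lc j) (smStep d Lc j) (coDressKBmAt (toSite (ctrOff (d + 1) Lc)) Lc (KInvStep (d := d) Lc j))) Lc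
          (fun κ₁ u₁ κ₂ u₂ => comp (comp (trK (psiKS (ctrOff (d + 1) Lc) Lc)) (slotPsiS (ctrOff (d + 1) Lc) Lc (slotPsiS (ctrOff (d + 1) Lc) Lc (unitS₂ (sfStep Lc j) (smStep d Lc j) (T2RecOf d Lc (GcombSh Lc) (SpureCombOf tabs cE cVH cΛ) tabs.M cE₂ cB Tc tabs.vh₂S tabs.mixFF j)) κ₁ u₁) κ₂ u₂)) (psiKS (ctrOff (d + 1) Lc) Lc)) := by
      funext κ u κ' u'
      exact lin4_unitK_GcombSh_eq_fourSlot j (cE₂ * (Lc : ℝ) ^ (2 * (d + 1))) hT hδT κ u κ' u'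
    rw [succ_combChart tabs cE cVH cΛ cE₂ cB Tc hBff hBmm j, e4]
  rw [hsplit, faceRead_conj_add (P : ℤ) (box (d + 1) P) hA (by positivity) hb hδb μ ν α β,
    faceRead_lin4_coDress_bondSym hLc hr (sfStep Lc j) (smStep d Lc j) (cE₂ * (Lc : ℝ) ^ (2 * (d + 1))) j hP hY hδY hYcov μ ν α β]
  ring

/-- NOT IN PRINT; OUR BOOKKEEPING.  **BOND-SYMMETRISED FORM**: `FFsym_P(T̃′♮_{j+1})(μ,ν;α,β) = FFsym_P(b̃′♮_j)(μ,ν;α,β) + c·K_j⁴·FFsym_{Lc·P}(Y_j)(μ,ν;α,β)` (two instances of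
`faceRead_member_succ`; the transported term is already bond-symmetric) — road-P2's text. -/
theorem faceReadSym_member_succ (tabs : SymTables d Lc) (cE cVH cΛ cE₂ cB : ℝ) (Tc : Fin 4 → Fin 4 → Fin 4 → Fin 4 → ℝ)
    (hBff : ∀ κ u κ' u' x z (α β : Fin (d + 1)), tabs.vh₂S κ u κ' u' x z (Sum.inl α) (Sum.inl β) = 0)
    (hBmm : ∀ κ u κ' u' x z (μ ν : Fin (d + 1)), tabs.vh₂S κ u κ' u' x z (Sum.inr μ) (Sum.inr ν) = 0)
    {P : ℕ} [NeZero (Lc * P)] (hP : 1 ≤ P) (j : ℕ) (μ ν α β : Fin (d + 1)) :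
    ((∑ b ∈ box (d + 1) P, ∑' u' : Site (d + 1), ∑' x : Site (d + 1), ∑' z : Site (d + 1),
          (if toSite b μ % (P : ℤ) = (P : ℤ) - 1 ∧ u' ν % (P : ℤ) = (P : ℤ) - 1 ∧ x α % (P : ℤ) = (P : ℤ) - 1 ∧ z β % (P : ℤ) = (P : ℤ) - 1 then
            unitS₂ (sfStep Lc (j + 1)) (smStep d Lc (j + 1)) (T2RecOf d Lc (GcombSh Lc) (SpureCombOf tabs cE cVH cΛ) tabs.M cE₂ cB Tc tabs.vh₂S tabs.mixFF (j + 1)) μ (toSite b) ν u' x z (Sum.inl α) (Sum.inl β) else 0))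
        + (∑ b ∈ box (d + 1) P, ∑' u' : Site (d + 1), ∑' x : Site (d + 1), ∑' z : Site (d + 1),
          (if toSite b ν % (P : ℤ) = (P : ℤ) - 1 ∧ u' μ % (P : ℤ) = (P : ℤ) - 1 ∧ x α % (P : ℤ) = (P : ℤ) - 1 ∧ z β % (P : ℤ) = (P : ℤ) - 1 then
            unitS₂ (sfStep Lc (j + 1)) (smStep d Lc (j + 1)) (T2RecOf d Lc (GcombSh Lc) (SpureCombOf tabs cE cVH cΛ) tabs.M cE₂ cB Tc tabs.vh₂S tabs.mixFF (j + 1)) ν (toSite b) μ u' x z (Sum.inl α) (Sum.inl β) else 0)))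
      = ((∑ b ∈ box (d + 1) P, ∑' u' : Site (d + 1), ∑' x : Site (d + 1), ∑' z : Site (d + 1),
          (if toSite b μ % (P : ℤ) = (P : ℤ) - 1 ∧ u' ν % (P : ℤ) = (P : ℤ) - 1 ∧ x α % (P : ℤ) = (P : ℤ) - 1 ∧ z β % (P : ℤ) = (P : ℤ) - 1 then
            (fun κ u κ' u' => (cE₂ * (Lc : ℝ) ^ (2 * (d + 1))) • mmRead Lc (K3OfK (unitK (sfStep Lc j) (smStep d Lc j) (GcombSh (d := d) Lc j)) Lc (unitS (sfStep Lc j) (smStep d Lc j) (SpureCombOf tabs cE cVH cΛ j)) (unitM (sfStep Lc j) (smStep d Lc j) (tabs.M j)) (W2SymOfK (unitK (sfStep Lc j) (smStep d Lc j) (GcombSh (d := d) Lc j)) Lc (unitS (sfStep Lc j) (smStep d Lc j) (SpureCombOf tabs cE cVH cΛ j)) (unitM (sfStep Lc j) (smStep d Lc j) (tabs.M j)) 0 (unitM₂ (sfStep Lc j) (smStep d Lc j) (M2Of d Lc tabs.mixFF j))) κ u κ' u') + cB • tabs.vh₂S κ u κ' u') μ (toSite b) ν u' x z (Sum.inl α)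 (Sum.inl β) else 0))
        + (∑ b ∈ box (d + 1) P, ∑' u' : Site (d + 1), ∑' x : Site (d + 1), ∑' z : Site (d + 1),
          (if toSite b ν % (P : ℤ) = (P : ℤ) - 1 ∧ u' μ % (P : ℤ) = (P : ℤ) - 1 ∧ x α % (P : ℤ) = (P : ℤ) - 1 ∧ z β % (P : ℤ) = (P : ℤ) - 1 then
            (fun κ u κ' u' => (cE₂ * (Lc : ℝ) ^ (2 * (d + 1))) • mmRead Lc (K3OfK (unitK (sfStep Lc j) (smStep d Lc j) (GcombSh (d := d) Lc j)) Lc (unitS (sfStep Lc j) (smStep d Lc j) (SpureCombOf tabs cE cVH cΛ j)) (unitM (sfStep Lc j) (smStep d Lc j) (tabs.M j)) (W2SymOfK (unitK (sfStep Lc j) (smStep d Lc j) (GcombSh (d := d) Lc j)) Lc (unitS (sfStep Lc j) (smStep d Lc j) (SpureCombOf tabs cE cVH cΛ j)) (unitM (sfStep Lc j) (smStep d Lc j) (tabs.M j)) 0 (unitM₂ (sfStep Lc j) (smStep d Lc j) (M2Of d Lc tabs.mixFF j))) κ u κ' u') + cB • tabs.vh₂S κ u κ' u') ν (toSite b) μ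 u' x z (Sum.inl α) (Sum.inl β) else 0)))
        + ((cE₂ * (Lc : ℝ) ^ (2 * (d + 1))) * (sfStep Lc j * smStep d Lc j * (stepScale d Lc j * (Lc : ℝ) ^ (d + 1))⁻¹) ^ 4) *
          ((∑ b ∈ box (d + 1) (Lc * P), ∑' u' : Site (d + 1), ∑' x : Site (d + 1), ∑' z : Site (d + 1),
          (if toSite b μ % ((Lc * P : ℕ) : ℤ) = ((Lc * P : ℕ) : ℤ) - 1 ∧ u' ν % ((Lc * P : ℕ) : ℤ) = ((Lc * P : ℕ) : ℤ) - 1 ∧ x α % ((Lc * P : ℕ) : ℤ) = ((Lc * P : ℕ) : ℤ) - 1 ∧ z β % ((Lc * P : ℕ) : ℤ) = ((Lc * P : ℕ) : ℤ) - 1 then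
            comp (comp (trK (psiKS (ctrOff (d + 1) Lc) Lc)) (slotPsiS (ctrOff (d + 1) Lc) Lc (slotPsiS (ctrOff (d + 1) Lc) Lc (unitS₂ (sfStep Lc j) (smStep d Lc j) (T2RecOf d Lc (GcombSh Lc) (SpureCombOf tabs cE cVH cΛ) tabs.M cE₂ cB Tc tabs.vh₂S tabs.mixFF j)) μ (toSite b)) ν u')) (psiKS (ctrOff (d + 1) Lc) Lc) x z (Sum.inl α) (Sum.inl β) else 0))
        + (∑ b ∈ box (d + 1) (Lc * P), ∑' u' : Site (d + 1), ∑' x : Site (d + 1), ∑' z : Site (d + 1),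
          (if toSite b ν % ((Lc * P : ℕ) : ℤ) = ((Lc * P : ℕ) : ℤ) - 1 ∧ u' μ % ((Lc * P : ℕ) : ℤ) = ((Lc * P : ℕ) : ℤ) - 1 ∧ x α % ((Lc * P : ℕ) : ℤ) = ((Lc * P : ℕ) : ℤ) - 1 ∧ z β % ((Lc * P : ℕ) : ℤ) = ((Lc * P : ℕ) : ℤ) - 1 then
            comp (comp (trK (psiKS (ctrOff (d + 1) Lc) Lc)) (slotPsiS (ctrOff (d + 1) Lc) Lc (slotPsiS (ctrOff (d + 1) Lc) Lc (unitS₂ (sfStep Lc j) (smStep d Lc j) (T2RecOf d Lc (GcombSh Lc) (SpureCombOf tabs cE cVH cΛ) tabs.M cE₂ cB Tc tabs.vh₂S tabs.mixFF j)) ν (toSite b)) μ u')) (psiKS (ctrOff (d + 1) Lc) Lc) x z (Sum.inl α) (Sum.inl β) else 0))) := by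
  rw [faceRead_member_succ tabs cE cVH cΛ cE₂ cB Tc hBff hBmm hP j μ ν α β, faceRead_member_succ tabs cE cVH cΛ cE₂ cB Tc hBff hBmm hP j ν μ α β]
  ring

end Summit.QuantumFields.BalabanUV.Beta.GAN24.CombChartChargeTowerStepDeep

end
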